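import Mathlib
import HarnessLib
import HarnessLib.Audit
import Summits.Langlands.Statement
import Literature.NumberTheory.PAdicHodge.FontaineDpst
import Literature.FieldTheory.AlgClosed.PadicAlgClEquivComplex
import Summits.Langlands.Langlands.Theorems.EisensteinDegreeShiftSectorComplementStubAvatarConjugacy
import Summits.Langlands.Langlands.Theorems.IrreducibilityBySelfDualityIrreducibleOffSectorOfWeak
import Summits.Langlands.Langlands.Theorems.IrreducibilityBySelfDualityIrreducibleOffSectorTransfer
import Literature.NumberTheory.GaloisRepresentations.ToLocalRestrictField
import Literature.NumberTheory.GaloisRepresentations.FramedRepEquivConj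
import Literature.NumberTheory.GaloisRepresentations.LAdicRepFrobenius
import Literature.NumberTheory.Automorphic.ChebotarevArtinRepHolds
import Literature.NumberTheory.Automorphic.PairLFunctionPolesRepData
import Literature.NumberTheory.Automorphic.LocalLanglandsGLProofs
import Literature.NumberTheory.Automorphic.LocalConstantsProofs
import HarnessLib.Audit.Status.Attr

/-!
Route: TriangularRankLadder

# Route TriangularRankLadder — the joint (A,B) rank ladder of GL(n) reciprocity is lower-triangular
— irreducibility and de Rham-ness of avatars at rank n from ONE geometric avatar, weak automorphy
below n, and Jacquet–Shalika

X = the born sibling PrimitiveRankLadder (route-Langlands-PrimitiveRankLadder: Langlands ⟸ RankOne ∧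
RankTwoPrimitive ∧ HigherRankPrimitive ∧
CyclicInductionTransport ∧ W⁺ ∧ P ∧ L∤R ∧ CRD) with its (A)-side binders W⁺ = SatakeAvatarExistence
(stmt-Langlands-17415: an IRREDUCIBLE avatar)
and clause (i) of P = PadicMemberCompatibility (stmt-Langlands-17534: every irreducible avatar de
Rham above ℓ) REPLACED by one strictly weaker
piece W_geo = GeometricAvatarExistence (SOME avatar unramified a.e., de Rham for the pinned datum,
Satake–Frobenius compatible a.e.; Buzzard–Gee
3.2.2 weak form, verbatim the registered stub_weakExistence of crux stmt-Langlands-14328) plus the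
two Jacquet–Shalika inputs AC Ch. 3 (2.2)/(2.3)
(Literature named facts) and the cross-prime transfer CrossPrimeClass (= clause (ii) of P). The
deletion is paid for by the sibling's OWN lower
grades: at rank n, irreducibility and de Rham-ness of every avatar follow from W_geo[n] and weak
automorphy B_w[m] for m < n (decomp-langlands
lens «grading ladder», gen 2; node file HOME/nodes/lens-1-g2-TriangularRankLadder.lean proves the
derivations, the exactness W_geo ⟺ W⁺ ∧ DR mod
(B-ladder, AC), and `closes`). No idea card realised (cell output).
REFINES (RESIDUAL MODE, D-0179): route-Langlands-PrimitiveRankLadder:SatakeAvatarExistence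
(stmt-Langlands-17415) and :PadicMemberCompatibility (stmt-Langlands-17534) — the (A)-column
residual pieces of this lineage's born route (no `--refines` flag yet; the edge is carried here, in
the item docstrings and in the node file's kernel theorems). WHY THIS IS NOVEL: no other filed axis
DERIVES W⁺ = 17415 — every sibling route (RootDecomp1, ResidualSplit, WeightMultiplicitySplit,
PrimitiveRankLadder, DepthPrimeSplit, AnchoredFamilySplit, MonodromyDichotomy) carries the
irreducible-avatar existence as an independent leaf; here the (A) column (irreducibility 23601,
semisimple avatar 23598, de Rham membership, hence W⁺ and clause (i) of P) becomes a KERNEL THEOREM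
of the (B) column strictly below rank n plus ONE strictly weaker new leaf W_geo and two PRINT
Jacquet–Shalika facts (`gradeA_of_gradeB_below`); the mechanism (JS (2.2)/(2.3) irreducibility
bootstrap, tree `Theorems.IrreducibleOffSector.isIrreducible_of_geometric_of_weakAutomorphyBelow`, +
de Rham transport along Chebotarev–Brauer–Nesbitt conjugacy) is KNOWN — novelty is claimed honestly
only as GRADING/PLACEMENT (critic: accepted on that basis). HONEST PRICE (critic, accepted): at the
census's box F04 (n = 4, CM, non-polarizable) Irr[4] now waits on B_w[2], B_w[3] over CM fields —
the triangle converts an (A)-side open problem into (B)-side debt, it does not discharge it.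
LINEAGE: NODE decomp-langlands-lens-1-g2 2026-08-30T02:37:42Z (HOME/STATUS.md L81), CLEARED by
decomp-langlands crit-1 CLEARED 2026-08-30T02:39:41Z (HOME/STATUS.md L85; HOME/CRITIC-LEDGER.md row
20) (TYPING ✓: W_geo pinned through Satake compatibility a.e., no junk inhabitant;
PairLBoundary/PairLPole = ALIASES of the Literature named facts
`JacquetShalika1981_partialPairL_boundary/pole_repData`; GUARDS target ROOT ✓, NECESSARY ✓, WEAKER ✓
strictly per piece, EXACT ✓ EQUIV once (W⁺ ∧ DR ⟺ W_geo mod B-ladder + JS), DISTRIBUTED ✓, COSTUME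
none, binder_used 10/10; leaf tags accepted), filing kit natively certified by the lens
(Route.md/route.json 11 items/glue.lean: rendered Theses rc0 · 0 sorry · closes axioms std); filed
by the cell's route-writer decomp-langlands-writer-1 (gen 2) as the CHILD route of
PrimitiveRankLadder (items shared by dedup). Census instrument of record:
HOME/census/COSTUME-CENSUS-v2.md sha256
92d1557a2c5727820a56011751c388b645a7fc2e57306ba099f059e21d7ae085 (rows F02–F05 / F16–F17 cited in
the lens card nodes/lens-1-g2-TriangularRankLadder.md). Rung currency: rung 0.
Lean: `RankOneAutomorphy ∧ RankTwoPrimitiveAutomorphy ∧ HigherRankPrimitiveAutomorphy ∧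
CyclicInductionTransport ∧ GeometricAvatarExistence ∧ PairLBoundary ∧ PairLPole ∧ CrossPrimeClass ∧
CompatibilityAwayFromLR ∧ CanonicalReciprocityData`

## Assembly
Level 2 (B): weak automorphy at every rank by strong induction (sibling, verbatim). Level 2 (A),
NEW: at rank n, from W_geo[n] and B_w[<n] and AC
(2.2)/(2.3): every compatible avatar irreducible (landed
isIrreducible_of_geometric_of_weakAutomorphyBelow), hence W⁺; every irreducible avatar
de Rham (conjugate to the geometric one by Chebotarev + Brauer–Nesbitt; frame invariance), hence
with CrossPrimeClass the whole of P. Level 1 =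
the sibling's / N0's assembly verbatim (prime switch ℓ' ∈ {2,3}, avatar transport through P,
uniqueness from the proved stub_avatarConjugacy).
`closes` in glue.lean (certified by `ledger route check --native`), all 10 binders used, 5 of them
open cruxes.

Rationale: WHY THIS LINE. The joint rank ladder of the two directions is LOWER-TRIANGULAR: grade n of
(A)-irreducibility (Ramakrishnan's problem; RootDecomp1's open crux
CuspidalAvatarIrreducible stmt-Langlands-23601) and of (A)-de Rham-ness needs direction (B) only at
ranks < n — a reducible pinned-geometric avatar
of a cuspidal π has irreducible pinned-geometric constituents of smaller rank (Fontaine 1994 Exp.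
III 1.5.2, landed `stub_deRhamBlocks`), each
weakly automorphic by B_w[<n], and Jacquet–Shalika isobaric rigidity (ArthurClozelAMS120 Ch. 3
(2.2)/(2.3), JacquetShalikaAJM1981II Thm 4.4)
forbids a cuspidal Satake family to be an isobaric sum of ≥ 2 cuspidals (Ramakrishnan
arXiv:0707.0502 §0; Calegari–Gee arXiv:1104.4827 §1.1,
whose ceiling n ≤ 5 is exactly «potential automorphy known in ranks ≤ 4»). The mechanism is LANDED
in the tree
(`IrreducibleOffSector.isIrreducible_of_geometric_of_weakAutomorphyBelow`, sorry-free);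
irreducibility and de Rham-ness then pass to EVERY
compatible avatar by Chebotarev + Brauer–Nesbitt
(`FramedGaloisRep.nonempty_equiv_of_hasFrobCharpolyAt_eventually` with the proved
`chebotarev_artinRep_holds`) and frame invariance of `IsDeRhamFramed`
(`PstWeilDeligneData.isDeRhamFramed_conj_iff`). Effect on the root cone:
the (A)-column {SemisimpleAvatar 23598, CuspidalAvatarIrreducible 23601, DeRhamMember ⊂ 17534, W⁺
17415} collapses to ONE open piece W_geo with
no new open piece added, and P's open content is isolated as the cross-prime transfer. Imported
area: analytic theory of Rankin–Selberg
L-functions (as print inputs) + ℓ-adic compatible-system transport; no prior route or node grades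
the (A)-side by rank or couples it to (B)[<n].

RANKED CRUXES. #2 RankTwoPrimitiveAutomorphy (crux) — Sibling item stmt-Langlands-24803 verbatim
(weak automorphy of irreducible pinned-geometric twist-primitive ρ of rank 2 over any number field)
— cited by id, attached by signature dedup, not re-typed. TAGS (shared by dedup =
stmt-Langlands-24803 `PrimitiveRankLadder.RankTwoPrimitiveAutomorphy`; critic rows 4/15/20): WEAKER
· OPEN · INSTRUMENTABLE — inherited unchanged from PrimitiveRankLadder; in the triangle it is ALSO
the (B)-input of (A)-irreducibility at grade 3. [difficulty: open-problem] (why it might fail: even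
rank-2 ρ of infinite image over ℚ, HT-irregular ρ over CM fields and any ρ over mixed-signature K
have no known automorphic construction; one non-automorphic geometric ρ₂ refutes it.)
[arXiv:0907.3427, Kisin2009FontaineMazur, KhareWintenberger2009, Pan2022LocallyAnalytic]
#3 HigherRankPrimitiveAutomorphy (crux) — Sibling item stmt-Langlands-24804 verbatim (weak
automorphy of irreducible pinned-geometric twist-primitive ρ of rank n ≥ 3): the (B)-residual of the
ladder; at grade n it is also what feeds (A)-irreducibility at grade n + 1. TAGS (shared by dedup =
stmt-Langlands-24804; critic rows 4/15/20): WEAKER · UNDECIDED-with-test (crit 02:19:17Z) ·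
IDEA-NEEDED · BARRIER TaylorWilesNumericalCoincidence_holds / ShimuraVarietyRealizationBarrier_holds
— the (B)-residual of the ladder, inherited; at grade n it feeds (A) at grade n + 1 (the HONEST
PRICE above). [difficulty: open-problem] (why it might fail: for non-polarizable or residually
inadequate ρ of rank ≥ 3 over a general number field only automorphy LIFTING / potential automorphy
exist; a single non-automorphic primitive geometric ρ₃ refutes it.) [ClozelHarrisTaylor2008,
BLGGT2014, ACCGHLNSTT2023]
#4 GeometricAvatarExistence (crux) — W_geo — every L-algebraic cuspidal π on GL_n over any number
field has, for every ℓ and ι, SOME ℓ-adic ρ unramified almost everywhere, de Rham above ℓ for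
Fontaine's pinned datum, and Satake–Frobenius compatible with (π, ι) almost everywhere (no
irreducibility asked). Verbatim the registered stub_weakExistence of crux stmt-Langlands-14328 (line
Sketch); implied by Langlands (landed weakExistence_of_langlands). TAGS (decomp-langlands crit-1
CLEARED 2026-08-30T02:39:41Z (HOME/STATUS.md L85; HOME/CRITIC-LEDGER.md row 20); census
HOME/census/COSTUME-CENSUS-v2.md sha256
92d1557a2c5727820a56011751c388b645a7fc2e57306ba099f059e21d7ae085): WEAKER (kernel
`Cert.geometricAvatarExistence_of_langlands`; W_geo < W⁺ strictly: on RA ∧ K ⊂ TR ∪ CM existence is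
PRINT-closed by HLTT 2016 / Scholze 2015 + AHTW 2026 Thm 1.2.1 while irreducibility (W⁺) is OPEN
there — a genuine weakening; exactness `Cert.aColumn_iff_geometricAvatarExistence`: W⁺ ∧ DR ⟺ W_geo
mod the B-ladder + JS, the node's ONE EQUIV; bc7 CLEAN,
nodes/lens-1-g2-TriangularRankLadder.bc7.txt) · OPEN · DEDUP PARENT: verbatim the registered
`stub_weakExistence` of crux stmt-Langlands-14328's line Sketch (cite; implied by Langlands via the
landed `weakExistence_of_langlands`) · leaf ATTACKABLE sector RA ∧ TR/CM (HLTT/Scholze + AHTW) ·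
IDEA-NEEDED irregular π_∞ / K not TR∪CM · BARRIER
`Literature.Barriers.Langlands.NonRegularWeightBarrier_holds` /
`ShimuraVarietyRealizationBarrier_holds` bound the construction engines (not evaded on the residual,
honestly said). [difficulty: open-problem] (why it might fail: non-cohomological π (Maass forms,
limits of discrete series beyond weight one) and π over mixed-signature K: no construction of any
ℓ-adic avatar is known; every known one passes through Shimura varieties (NonRegularWeightBarrier,
ShimuraVarietyRealizationBarrier).) [BuzzardGeeLMS2014, HarrisLanTaylorThorneRMS2016, Scholze2015,
arXiv:2607.11763]
#5 CrossPrimeClass (crux) — Cross-prime transfer of local–global compatibility at v ∣ ℓ (clause (ii)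
of sibling item stmt-Langlands-17534, writer frame piece verbatim): for an irreducible ℓ-adic avatar
ρ of an L-algebraic cuspidal π and a place v above ℓ, local–global compatibility at v for Rec
follows from that of any irreducible ℓ'-adic avatar ρ' of π with ℓ' not below v. TAGS
(decomp-langlands crit-1 CLEARED 2026-08-30T02:39:41Z (HOME/STATUS.md L85; HOME/CRITIC-LEDGER.md row
20); census HOME/census/COSTUME-CENSUS-v2.md sha256
92d1557a2c5727820a56011751c388b645a7fc2e57306ba099f059e21d7ae085): = clause (ii) of P
(stmt-Langlands-17534) VERBATIM = the writer frame piece P(ii) (kernel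
`Cert.crossPrimeClass_of_padicMemberCompatibility`: P ⇒ CrossPrimeClass; CrossPrimeClass < P
strictly: clause (i) de Rham membership is now DERIVED) · WEAKER · OPEN · leaf ATTACKABLE sector
polarizable (Caraiani 2012/2014 ℓ = p local–global compatibility, BLGGT) · BARRIER
`Literature.Barriers.Langlands.MonodromyNotClosedUnderPadicLimits` (the slot where lens-6's LGCAbove
carving — RootDecomp1's GenericFibre 25107 / RecPreservesGenericity 25108 / GenericWDUnique 2374 —
plugs in). [difficulty: open-problem] (why it might fail: for avatars built by congruences (torsion
classes, non-polarizable RA π over CM fields) compatibility at v ∣ ℓ is known only up to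
semisimplification / monodromy (MonodromyNotClosedUnderPadicLimits); the framed statement needs
Fontaine's C_WD for the compatible system.) [Caraiani2014, BLGGT2014, arXiv:2607.11763]
#6 CompatibilityAwayFromLR (crux) — N0/sibling item stmt-Langlands-18084 verbatim (local–global
compatibility at the places v not above ℓ, for every Rec) — cited by id, attached by signature
dedup, not re-typed. TAGS (shared N0 item stmt-Langlands-18084 by dedup; critic rows 1/20): WEAKER ·
OPEN · inherited unchanged (BARRIER MonodromyNotClosedUnderPadicLimits). [difficulty: open-problem]
(why it might fail: full (monodromy included) local–global compatibility at ramified v ∤ ℓ is known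
only for Shimura-type / polarizable π (Caraiani 2012) and up to monodromy in general (Varma); a
torsion-class avatar with wrong monodromy refutes it.) [Caraiani2012, Varma2014,
HarrisLanTaylorThorneRMS2016]
#9 RankOneAutomorphy (support) — Sibling item stmt-Langlands-24805 verbatim (rank one: class field
theory + Weil + Serre); grade 1 of (B), the only (B)-input of grade 2 of (A). TAGS (shared by dedup
= stmt-Langlands-24805; PRINT support · WEAKER · ATTACKABLE: CFT + Weil + Serre III.2.3) — grade 1
of (B), the only (B)-input of grade 2 of (A). [difficulty: M] [Weil1956, SerreAbelianLadic1968]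
#9 CyclicInductionTransport (support) — Sibling item stmt-Langlands-24806 verbatim (automorphic
induction along cyclic layers, given all lower grades). TAGS (shared by dedup =
stmt-Langlands-24806; PRINT support · WEAKER · ATTACKABLE: Arthur–Clozel cyclic automorphic
induction given all lower grades). [difficulty: L] [ArthurClozelAMS120, Henniart2012]
#9 PairLBoundary (support) — Arthur–Clozel Ch. 3 (2.2) for Borel–Jacquet data: finite non-zero
boundary values of the partial Rankin–Selberg L-function on Re s = 1 off the polar set — the
Literature named fact itself (no _holds yet; = stmt-Langlands-13622 unfolded). TAGS
(decomp-langlands crit-1 CLEARED 2026-08-30T02:39:41Z (HOME/STATUS.md L85; HOME/CRITIC-LEDGER.md row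
20)): PRINT support = ALIAS of the Literature named fact
`Literature.NumberTheory.Automorphic.JacquetShalika1981_partialPairL_boundary_repData`
(PairLFunctionPolesRepData.lean :158, reduced there to L² leaves by the `_of_L2` theorems; =
stmt-Langlands-13622 unfolded) · ATTACKABLE (Literature proof item) · no catalogued barrier.
[difficulty: L] [ArthurClozelAMS120, JacquetShalikaAJM1981II]
#9 PairLPole (support) — Arthur–Clozel Ch. 3 (2.3): the simple pole of the partial Rankin–Selberg
L-function of a cuspidal pair on the polar set — the Literature named fact itself (no _holds yet).
TAGS (decomp-langlands crit-1 CLEARED 2026-08-30T02:39:41Z (HOME/STATUS.md L85;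
HOME/CRITIC-LEDGER.md row 20)): PRINT support = ALIAS of the Literature named fact
`Literature.NumberTheory.Automorphic.JacquetShalika1981_partialPairL_pole_repData`
(PairLFunctionPolesRepData.lean :182) · ATTACKABLE · no catalogued barrier. [difficulty: L]
[ArthurClozelAMS120, JacquetShalikaAJM1981II]
#9 CanonicalReciprocityData (support) — N0/sibling item stmt-Langlands-17930 verbatim (a reciprocity
datum exists for every number field) — cited by id. TAGS (shared N0 item stmt-Langlands-17930 by
dedup): PRINT support · ATTACKABLE. [difficulty: M] [HarrisTaylor2001, Fontaine1994]

TWO-LAYER PLAN. GeometricAvatarExistence ⇐ (π regular algebraic ∧ K CM or totally real: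
closed-mod-print — exists_galoisRep_of_regularAlgebraic + AHTW2026
deRham_hodgeTateRegular + a pinned-datum comparison) ∧ (non-cohomological π / mixed-signature K:
declared residual) once a typed infinity-type
predicate is agreed with lens-2 (weight axis). CrossPrimeClass ⇐ (Shimura-type sector: Caraiani) ∧
(congruence-built avatars). Nothing filed now.

KILL CRITERIA. A refutation of GeometricAvatarExistence refutes Langlands itself (landed
weakExistence_of_langlands) — it would close the summit negatively, not
just this route. A cheap proof of `GeometricAvatarExistence → SatakeAvatarExistence` NOT using the
(B)-grades (e.g. a direct irreducibility
theorem for all n in print) makes the triangular coupling decorative: then re-glue with W⁺ and drop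
AC (2.2)/(2.3). A refutation of PairLBoundary /
PairLPole as TYPED (normalisation slip) is formalization debt: restate with the repaired fact text
(the sibling IrreducibilityBySelfDuality did so).

NOT DECOMPOSED YET. The infinity type (cohomological vs not) inside W_geo; the field signature;
CrossPrimeClass by construction method of the avatar. The (A)-side
rank grades themselves are NOT filed as separate items (W_geo is one item for all n): the triangular
coupling lives in the glue, not in the item list.

CHEAPEST FALSIFIER. `lean check` of HOME/nodes/lens-1-g2-TriangularRankLadder.probes.lean (done: rc
0): the batteries `GeometricAvatarExistence → SatakeAvatarExistence`,
`GeometricAvatarExistence ∧ PairLBoundary ∧ PairLPole → SatakeAvatarExistence` and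
`SatakeAvatarExistence → GeometricAvatarExistence` must all FAIL
(they do) — if the first succeeded the node would be W⁺ in costume. Second: `ledger negatives
--problem Langlands` against the four new decls (clean).

NUMBERS. (A)-irreducibility in print: n = 2 (Ribet 1977), n = 3 (Blasius–Rogawski), n ≤ 5 for RAESDC
π over totally real F and 100 % of ℓ
(Calegari–Gee arXiv:1104.4827 Thms 1.1–1.3), positive density of ℓ for all n (Patrikis–Taylor 2015);
the node's grade-2 statement needs only
B_w[1] (print). W_geo in print: all n for RA π over CM/TR (HLTT 2016 Thm A, Scholze 2015 V.4.2; de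
Rham: arXiv:2607.11763 Thm 1.2.1).

DEFINITION REQUESTS. None: IsPinnedGeometric / WeakAutomorphyAtRank / the graded (A)-predicates are
inlined or live only in the node file's derived theorems.

Novelty: Searches (2026-08-30): lit search --hybrid «irreducibility automorphic Galois representations GL(n)
low rank potential automorphy» → [corpus: arXiv:1104.4827 Calegari–Gee] Thms 1.1–1.3 (n ≤ 5),
Ramakrishnan arXiv:0707.0502; lean search
`isIrreducible_of_geometric_of_weakAutomorphyBelow|weakExistence_of_langlands|isobaricRigidity_of_JS`
→ the landed Theorems files cited above (crux level, flat in n); cell TREE.md axis A3 («W⁺ ⟸ SS ∧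
Irr — file only with genuinely new content») and every NODE line on HOME/STATUS.md: none grades the
(A)-side or couples it to (B)[<n]; lit galaxy search «Ramakrishnan irreducibility|isobaric cuspidal»
--star all → CG 2013, Ramakrishnan 2008 only.
Nearest prior art found: Calegari–Gee, Irreducibility of automorphic Galois representations of
GL(n), n at most 5 (arXiv:1104.4827) §1.1 — the induction «irreducibility at rank n from potential
automorphy below n»; in tree: crux stmt-Langlands-14328 line Sketch (W ∧ B_w ∧ I ⇒ R, all ranks at
once) and route IrreducibilityBySelfDuality (dormant).
Delta: promotes the Ramakrishnan/Calegari–Gee bootstrap from a crux-level lemma to the ROOT frame as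
a GRADED, lower-triangular coupling of the two directions on the twist-primitive rank ladder, so
that the root cone's whole (A)-column (W⁺, SS, Irr, DR) is one strictly weaker piece W_geo and de
Rham-ness of all avatars is derived by frame transport.
Claimed grade: new-combination  [refs: 1104.4827, 0707.0502]

Barriers (technique_class: rank-induction, isobaric-rigidity, frame-transport): - technique_class: rank-induction, isobaric-rigidity, frame-transport
- Literature.Barriers.Langlands.NonRegularWeightBarrier: applies to GeometricAvatarExistence on
non-cohomological π (the crux sits INSIDE the class of cohomological constructions there); not
evaded; recorded as the residual/BARRIER leaf of W_geo; the derived statements (irreducibility, de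
Rham of all avatars) are OUTSIDE it — they use no construction.
- Literature.Barriers.Langlands.ShimuraVarietyRealizationBarrier: applies to
GeometricAvatarExistence over mixed-signature K; not evaded (same leaf).
- Literature.Barriers.Langlands.MonodromyNotClosedUnderPadicLimits: applies to CrossPrimeClass and
CompatibilityAwayFromLR for congruence-built avatars; not evaded; the bet is Caraiani-type geometric
input in the Shimura sector and a new idea off it.
- Literature.Barriers.Langlands.TwistedEndoscopySelfDual: applies to HigherRankPrimitiveAutomorphy
(sibling card); through the triangular coupling it is also what caps (A)-irreducibility at n ≤ 5 in
print (Calegari–Gee) — placed, not evaded.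
- Literature.Barriers.Langlands.TaylorWilesNumericalCoincidence: applies to both (B)-grades off
TR/CM (sibling card); not evaded.
- Literature.Barriers.Langlands.SolvableImageBarrier: the sibling's cut runs along it
(CyclicInductionTransport inside, primitive grades outside); unchanged here.
- Literature.Barriers.Langlands.ResiduallyReducibleBarrier: inside both (B)-grades (sibling card);
the (A)-derivations are insensitive to th

sub-problem: Langlands · status: draft · opened planner-decomp-langlands-writer-1-g2-0 2026-08-30T02:49:34Z · rev 1 · ledger route-Langlands-TriangularRankLadder
GENERATED by the gate from the ledger (D-0016/17). Provers cite these decls: `theorem foo : Summit.Langlands.Langlands.Theses.TriangularRankLadder.<Decl> := …` in Summits/Langlands/Langlands/Theorems/<Name>.lean.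
-/

namespace Summit.Langlands.Langlands.Theses.TriangularRankLadder

open scoped BigOperators Topology Manifold Classical MeasureTheory ProbabilityTheory Matrix InnerProductSpace ComplexConjugate ContinuousMap
open Filter Set Function TopologicalSpace MeasureTheory

attribute [summit_statement] _root_.Langlands

/-- item stmt-Langlands-24803 · crux · rank 2 · open · by planner
why it might fail: even rank-2 ρ of infinite image over ℚ, HT-irregular ρ over CM fields and any ρ over mixed-signature K have no known automorphic construction; one non-automorphic geometric ρ₂ refutes it.
sources: arXiv:0907.3427, Kisin2009FontaineMazur, KhareWintenberger2009, Pan2022LocallyAnalytic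
[crux] Weak (a.e. Satake–Frobenius) automorphy of every irreducible pinned-geometric ℓ-adic ρ of
rank 2 over any number field WITHOUT self-twist (non-dihedral): an L-algebraic cuspidal π on GL₂
matching ρ at almost all places. Houses the live rank-2 routes as sectors (SqrtFiveQuarticCovers
17832, SkinnerWilesDefectOne 12918, EvenArtin* 2903/2905); dihedral ρ go to
CyclicInductionTransport. TAGS (crit-1 CLEARED 2026-08-30T01:33:42Z, row 4; census sha256
4dd86a1c…): WEAKER(kernel `weakGeometricAutomorphy_iff_pieces` in the node file; omits rank ≠ 2 and
every self-twisted ρ) · OPEN · leaf INSTRUMENTABLE[sectors closed-mod-print: FM GL₂/ℚ odd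
(Kisin2009FontaineMazur, KhareWintenberger2009, Pan2022LocallyAnalytic), TR ρ_E
(FreitasLeHungSiksek2015; SqrtFiveQuarticCovers 17832), SkinnerWilesDefectOne 12918, EvenArtin
2903–2905 — cite the items, do not re-type] · residual IDEA-NEEDED (even infinite image,
HT-irregular CM, mixed signature) · BARRIER(`ShimuraVarietyRealizationBarrier_holds`,
`NonRegularWeightBarrier_holds`, `ResiduallyReducibleBarrier_holds`,
`SolvableImageBarrierNarrow_holds`). [difficulty: open-problem] -/
@[route_item "route-Langlands-TriangularRankLadder", crux]
def RankTwoPrimitiveAutomorphy : Prop :=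
  ∀ (K : Type) [Field K] [NumberField K] (hcpt : Literature.NumberTheory.Automorphic.isCompact_glFiniteIntegralLevel 2 K) (ℓ : ℕ) [Fact ℓ.Prime] (ι : PadicAlgCl ℓ ≃+* ℂ) (ρ : Literature.NumberTheory.GaloisRepresentations.FramedGaloisRep K (PadicAlgCl ℓ) 2), ρ.toGaloisRep.IsIrreducible → ((∀ᶠ v : IsDedekindDomain.HeightOneSpectrum (NumberField.RingOfIntegers K) in Filter.cofinite, ρ.IsUnramifiedAt v) ∧ ∀ (v : IsDedekindDomain.HeightOneSpectrum (NumberField.RingOfIntegers K)) (hv : ((ℓ : ℕ) : NumberField.RingOfIntegers K) ∈ v.asIdeal), (Literature.NumberTheory.PAdicHodge.fontainePstAdicCompletion v ℓ hv).IsDeRhamFramed (ρ.toLocal v)) → ¬ (∃ η : Literature.NumberTheory.GaloisRepresentations.FramedGaloisRep K (PadicAlgCl ℓ) 1, (∃ᶠ v : IsDedekindDomain.HeightOneSpectrum (NumberField.RingOfIntegers K) in Filter.cofinite, ∃ a : PadicAlgCl ℓ, a ≠ 1 ∧ η.HasFrobCharpolyAt v (Polynomial.X - Polynomial.C a)) ∧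 ∀ᶠ v : IsDedekindDomain.HeightOneSpectrum (NumberField.RingOfIntegers K) in Filter.cofinite, ∃ (P : Polynomial (PadicAlgCl ℓ)) (a : PadicAlgCl ℓ), ρ.HasFrobCharpolyAt v P ∧ η.HasFrobCharpolyAt v (Polynomial.X - Polynomial.C a) ∧ P.scaleRoots a = P) → ∃ π : Literature.NumberTheory.Automorphic.CuspidalAutomorphicRepData 2 K hcpt, π.1.IsLAlgebraic ∧ ∀ᶠ v : IsDedekindDomain.HeightOneSpectrum (NumberField.RingOfIntegers K) in Filter.cofinite, SatakeFrobCompatibleAt ι π.1 ρ v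

/-- item stmt-Langlands-24804 · crux · rank 3 · open · by planner
why it might fail: for non-polarizable or residually inadequate ρ of rank ≥ 3 over a general number field only automorphy LIFTING / potential automorphy exist; a single non-automorphic primitive geometric ρ₃ refutes it.
sources: ClozelHarrisTaylor2008, BLGGT2014, ACCGHLNSTT2023
[crux] Weak automorphy of every irreducible pinned-geometric ℓ-adic ρ of rank n ≥ 3 over any number
field WITHOUT self-twist (not cyclically induced): the residual of the ladder. Strictly weaker than
B_w is UNDECIDED with test «a printed de-symmetrisation of WEAK automorphy Sym²ρ₂ ⇒ ρ₂ in the open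
grade-2 core»; instrumentable sub-sector: regular, polarizable, residually adequate and residually
automorphic (BLGGT Thm 4.2.1), CM non-polarizable (ACC+ Thm 6.1.1). TAGS (crit-1 CLEARED
2026-08-30T01:33:42Z, row 4): WEAKER than S; vs RankTwoPrimitiveAutomorphy UNDECIDED[test: «Ad ρ₂
weakly automorphic ⇒ ρ₂ ⊗ χ weakly automorphic for some Hecke χ, for non-cohomological primitive ρ₂»
— not in print (crit-1 re-ran it: sign-spread needs ρ_{π₂}; the ⊗-auxiliary route dies on GL₆ zeros
= CPSConverseGL1 18579); if it lands, re-cut by functorial primitivity] · OPEN · IDEA-NEEDED · leaf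
INSTRUMENTABLE sub-sector [BLGGT2014 Thm 4.2.1, ACCGHLNSTT2023 Thm 6.1.1] ·
BARRIER(`TwistedEndoscopySelfDual_holds`, `TaylorWilesNumericalCoincidence_holds`,
`NonRegularWeightBarrier_holds`, `ShimuraVarietyRealizationBarrier_holds`). [difficulty:
open-problem] -/
@[route_item "route-Langlands-TriangularRankLadder", crux]
def HigherRankPrimitiveAutomorphy : Prop :=
  ∀ (K : Type) [Field K] [NumberField K] (n : ℕ) (hcpt : Literature.NumberTheory.Automorphic.isCompact_glFiniteIntegralLevel n K), 3 ≤ n → ∀ (ℓ : ℕ) [Fact ℓ.Prime] (ι : PadicAlgCl ℓ ≃+* ℂ) (ρ : Literature.NumberTheory.GaloisRepresentations.FramedGaloisRep K (PadicAlgCl ℓ) n), ρ.toGaloisRep.IsIrreducible → ((∀ᶠ v : IsDedekindDomain.HeightOneSpectrum (NumberField.RingOfIntegers K) in Filter.cofinite, ρ.IsUnramifiedAt v) ∧ ∀ (v : IsDedekindDomain.HeightOneSpectrum (NumberField.RingOfIntegers K)) (hv : ((ℓ : ℕ) : NumberField.RingOfIntegers K) ∈ v.asIdeal), (Literature.NumberTheory.PAdicHodge.fontainePstAdicCompletion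 v ℓ hv).IsDeRhamFramed (ρ.toLocal v)) → ¬ (∃ η : Literature.NumberTheory.GaloisRepresentations.FramedGaloisRep K (PadicAlgCl ℓ) 1, (∃ᶠ v : IsDedekindDomain.HeightOneSpectrum (NumberField.RingOfIntegers K) in Filter.cofinite, ∃ a : PadicAlgCl ℓ, a ≠ 1 ∧ η.HasFrobCharpolyAt v (Polynomial.X - Polynomial.C a)) ∧ ∀ᶠ v : IsDedekindDomain.HeightOneSpectrum (NumberField.RingOfIntegers K) in Filter.cofinite, ∃ (P : Polynomial (PadicAlgCl ℓ)) (a : PadicAlgCl ℓ), ρ.HasFrobCharpolyAt v P ∧ η.HasFrobCharpolyAt v (Polynomial.X - Polynomial.C a) ∧ P.scaleRoots a = P) → ∃ π : Literature.NumberTheory.Automorphic.CuspidalAutomorphicRepData n K hcpt, π.1.IsLAlgebraic ∧ ∀ᶠ v : IsDedekindDomain.HeightOneSpectrum (NumberField.RingOfIntegers K) in Filter.cofinite, SatakeFrobCompatibleAt ι π.1 ρ v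

/-- item stmt-Langlands-25718 · crux · rank 4 · open · by planner
why it might fail: non-cohomological π (Maass forms, limits of discrete series beyond weight one) and π over mixed-signature K: no construction of any ℓ-adic avatar is known; every known one passes through Shimura varieties (NonRegularWeightBarrier, ShimuraVarietyRealizationBarrier).
sources: BuzzardGeeLMS2014, HarrisLanTaylorThorneRMS2016, Scholze2015, arXiv:2607.11763
[crux] W_geo — every L-algebraic cuspidal π on GL_n over any number field has, for every ℓ and ι,
SOME ℓ-adic ρ unramified almost everywhere, de Rham above ℓ for Fontaine's pinned datum, and
Satake–Frobenius compatible with (π, ι) almost everywhere (no irreducibility asked). Verbatim the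
registered stub_weakExistence of crux stmt-Langlands-14328 (line Sketch); implied by Langlands
(landed weakExistence_of_langlands). TAGS (decomp-langlands crit-1 CLEARED 2026-08-30T02:39:41Z
(HOME/STATUS.md L85; HOME/CRITIC-LEDGER.md row 20); census HOME/census/COSTUME-CENSUS-v2.md sha256
92d1557a2c5727820a56011751c388b645a7fc2e57306ba099f059e21d7ae085): WEAKER (kernel
`Cert.geometricAvatarExistence_of_langlands`; W_geo < W⁺ strictly: on RA ∧ K ⊂ TR ∪ CM existence is
PRINT-closed by HLTT 2016 / Scholze 2015 + AHTW 2026 Thm 1.2.1 while irreducibility (W⁺) is OPEN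
there — a genuine weakening; exactness `Cert.aColumn_iff_geometricAvatarExistence`: W⁺ ∧ DR ⟺ W_geo
mod the B-ladder + JS, the node's ONE EQUIV; bc7 CLEAN,
nodes/lens-1-g2-TriangularRankLadder.bc7.txt) · OPEN · DEDUP PARENT: verbatim the registered
`stub_weakExistence` of crux stmt-Langlands-14328's line Sketch (cite; implied by Langlands v -/
@[route_item "route-Langlands-TriangularRankLadder", crux]
def GeometricAvatarExistence : Prop :=
  ∀ (K : Type) [Field K] [NumberField K] (n : ℕ) (hcpt : Literature.NumberTheory.Automorphic.isCompact_glFiniteIntegralLevel n K), 0 < n → ∀ (π : Literature.NumberTheory.Automorphic.CuspidalAutomorphicRepData n K hcpt), π.1.IsLAlgebraic → ∀ (ℓ : ℕ) [Fact ℓ.Prime] (ι : PadicAlgCl ℓ ≃+* ℂ), ∃ ρ : Literature.NumberTheory.GaloisRepresentations.FramedGaloisRep K (PadicAlgCl ℓ) n, ((∀ᶠ v : IsDedekindDomain.HeightOneSpectrum (NumberField.RingOfIntegers K) in Filter.cofinite, ρ.IsUnramifiedAt v) ∧ ∀ (v : IsDedekindDomain.HeightOneSpectrum (NumberField.RingOfIntegers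 K)) (hv : ((ℓ : ℕ) : NumberField.RingOfIntegers K) ∈ v.asIdeal), (Literature.NumberTheory.PAdicHodge.fontainePstAdicCompletion v ℓ hv).IsDeRhamFramed (ρ.toLocal v)) ∧ ∀ᶠ v : IsDedekindDomain.HeightOneSpectrum (NumberField.RingOfIntegers K) in Filter.cofinite, SatakeFrobCompatibleAt ι π.1 ρ v

/-- item stmt-Langlands-25719 · crux · rank 5 · open · by planner
why it might fail: for avatars built by congruences (torsion classes, non-polarizable RA π over CM fields) compatibility at v ∣ ℓ is known only up to semisimplification / monodromy (MonodromyNotClosedUnderPadicLimits); the framed statement needs Fontaine's C_WD for the compatible system.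
sources: Caraiani2014, BLGGT2014, arXiv:2607.11763
[crux] Cross-prime transfer of local–global compatibility at v ∣ ℓ (clause (ii) of sibling item
stmt-Langlands-17534, writer frame piece verbatim): for an irreducible ℓ-adic avatar ρ of an
L-algebraic cuspidal π and a place v above ℓ, local–global compatibility at v for Rec follows from
that of any irreducible ℓ'-adic avatar ρ' of π with ℓ' not below v. TAGS (decomp-langlands crit-1
CLEARED 2026-08-30T02:39:41Z (HOME/STATUS.md L85; HOME/CRITIC-LEDGER.md row 20); census
HOME/census/COSTUME-CENSUS-v2.md sha256
92d1557a2c5727820a56011751c388b645a7fc2e57306ba099f059e21d7ae085): = clause (ii) of P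
(stmt-Langlands-17534) VERBATIM = the writer frame piece P(ii) (kernel
`Cert.crossPrimeClass_of_padicMemberCompatibility`: P ⇒ CrossPrimeClass; CrossPrimeClass < P
strictly: clause (i) de Rham membership is now DERIVED) · WEAKER · OPEN · leaf ATTACKABLE sector
polarizable (Caraiani 2012/2014 ℓ = p local–global compatibility, BLGGT) · BARRIER
`Literature.Barriers.Langlands.MonodromyNotClosedUnderPadicLimits` (the slot where lens-6's LGCAbove
carving — RootDecomp1's GenericFibre 25107 / RecPreservesGenericity 25108 / GenericWDUnique 2374 —
plugs in). [difficulty: open-problem] -/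
@[route_item "route-Langlands-TriangularRankLadder", crux]
def CrossPrimeClass : Prop :=
  ∀ (K : Type) [Field K] [NumberField K] (n : ℕ) (hcpt : Literature.NumberTheory.Automorphic.isCompact_glFiniteIntegralLevel n K), 0 < n → ∀ (π : Literature.NumberTheory.Automorphic.CuspidalAutomorphicRepData n K hcpt), π.1.IsLAlgebraic → ∀ (ℓ : ℕ) [Fact ℓ.Prime] (ι : PadicAlgCl ℓ ≃+* ℂ) (ρ : Literature.NumberTheory.GaloisRepresentations.FramedGaloisRep K (PadicAlgCl ℓ) n), ρ.toGaloisRep.IsIrreducible → (∀ᶠ v : IsDedekindDomain.HeightOneSpectrum (NumberField.RingOfIntegers K) in cofinite, SatakeFrobCompatibleAt ι π.1 ρ v) → ∀ (v : IsDedekindDomain.HeightOneSpectrum (NumberField.RingOfIntegers K)) (hv : ((ℓ : ℕ) : NumberField.RingOfIntegers K) ∈ v.asIdeal), ∀ (Rec : ReciprocityData K) (ℓ' : ℕ) [Fact ℓ'.Prime] (ι' : PadicAlgCl ℓ' ≃+* ℂ) (ρ' : Literature.NumberTheory.GaloisRepresentations.FramedGaloisRep K (PadicAlgCl ℓ') n),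 ((ℓ' : ℕ) : NumberField.RingOfIntegers K) ∉ v.asIdeal → ρ'.toGaloisRep.IsIrreducible → (∀ᶠ w : IsDedekindDomain.HeightOneSpectrum (NumberField.RingOfIntegers K) in cofinite, SatakeFrobCompatibleAt ι' π.1 ρ' w) → LocalGlobalCompatibleAt Rec ι' π.1 ρ' v → LocalGlobalCompatibleAt Rec ι π.1 ρ v

/-- item stmt-Langlands-18084 · crux · rank 6 · open · by planner
why it might fail: full (monodromy included) local–global compatibility at ramified v ∤ ℓ is known only for Shimura-type / polarizable π (Caraiani 2012) and up to monodromy in general (Varma); a torsion-class avatar with wrong monodromy refutes it.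
sources: Caraiani2012, Varma2014, HarrisLanTaylorThorneRMS2016
[crux] L∤R — Taylor 2004 Conj. 7 at the places v ∤ ℓ, in the `∀ Rec` form (rev 4, lockstep re-type
after the summit re-type p141787 `∀ F, Nonempty (ReciprocityData F) ∧ ∀ 𝓡 …`): for every number
field K and EVERY reciprocity datum Rec (Henniart-normalised local Langlands data with THE canonical
Artin pins — the summit's `∀ 𝓡`), every n ≥ 1 and hcpt, every L-algebraic cuspidal π of GL_n(𝔸_K),
every (ℓ, ι) and every IRREDUCIBLE ρ : Γ_K → GL_n(ℚ̄_ℓ) that is pinned-geometric (unramified a.e.,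
de Rham above ℓ for Fontaine's pinned datum) and Satake–Frobenius compatible with (π, ι) a.e.:
`LocalGlobalCompatibleAt Rec ι π ρ v` at every finite v ∤ ℓ (Grothendieck–Deligne Weil–Deligne
representation, Frobenius-semisimplified, ↔ rec_v(π_v)). = item L∤ (stmt-Langlands-17417, ∃-Rec
form; verbatim the registered stub `stub_pairCompatibilityAway` of line `Sketch` of crux 14328) with
Rec moved from `∃ Rec,` to a universal binder after K and nothing else changed; the ∃-form is
implied back by L∤R ∧ CanonicalReciprocityData (`compatibilityAwayFromL_existsForm`).
Kernel-certified consequence of the re-typed summit (`compatibilityAwayFromLR_of_langlands`, planner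
bc/SubsOfLanglandsR.lean: direction (A -/
@[route_item "route-Langlands-TriangularRankLadder", crux]
def CompatibilityAwayFromLR : Prop :=
  ∀ (K : Type) [Field K] [NumberField K] (Rec : ReciprocityData K) (n : ℕ) (hcpt : Literature.NumberTheory.Automorphic.isCompact_glFiniteIntegralLevel n K), 0 < n → ∀ (π : Literature.NumberTheory.Automorphic.CuspidalAutomorphicRepData n K hcpt), π.1.IsLAlgebraic → ∀ (ℓ : ℕ) [Fact ℓ.Prime] (ι : PadicAlgCl ℓ ≃+* ℂ) (ρ : Literature.NumberTheory.GaloisRepresentations.FramedGaloisRep K (PadicAlgCl ℓ) n), ρ.toGaloisRep.IsIrreducible → ((∀ᶠ v : IsDedekindDomain.HeightOneSpectrum (NumberField.RingOfIntegers K) in cofinite, ρ.IsUnramifiedAt v) ∧ ∀ (v : IsDedekindDomain.HeightOneSpectrum (NumberField.RingOfIntegers K)) (hv : ((ℓ : ℕ) : NumberField.RingOfIntegers K) ∈ v.asIdeal), (Literature.NumberTheory.PAdicHodge.fontainePstAdicCompletion v ℓ hv).IsDeRhamFramed (ρ.toLocal v)) → (∀ᶠ v : IsDedekindDomain.HeightOneSpectrum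 (NumberField.RingOfIntegers K) in cofinite, SatakeFrobCompatibleAt ι π.1 ρ v) → ∀ v : IsDedekindDomain.HeightOneSpectrum (NumberField.RingOfIntegers K), ((ℓ : ℕ) : NumberField.RingOfIntegers K) ∉ v.asIdeal → LocalGlobalCompatibleAt Rec ι π.1 ρ v

/-- item stmt-Langlands-17930 · support · rank 9 · open · by planner
sources: HarrisTaylor2001, Fontaine1994
[support] THE SUMMIT'S NON-VACUITY CONJUNCT, verbatim (statement revision p141787, 2026-08-17:
`Langlands := ∀ F, Nonempty (ReciprocityData F) ∧ ∀ 𝓡 n, 0 < n → ∀ hcpt, GLC n F 𝓡 hcpt`, with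
`ReciprocityData` pinned to THE local Artin maps by `llc_isCanonical` / `llc_eps_isCanonical`),
filed by route-repair 5a1bd9af as the explicit INPUT of this route's `∃ RD`-shaped slices
(LiftB2Unram, LiftB2UnramSmallF, LiftB2UnramLargeF, LiftB2UnramSplitP): for every number field F and
every finite place v, a local Langlands datum for GL_n(F_v) (Harris–Taylor 2001 Thm A; Henniart 2000
Thm 1.2) normalised against THE local Artin map `canonicalArtin (F_v)`, whose ε-system (Deligne 1973
Thm 4.1) is normalised against the canonical Artin map of every finite E/F_v. IN PRINT,
textbook-grade input (Harris–Taylor's Thm A is stated relative to Art_K of local class field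
theory); in the TREE not yet derivable — `LocalLanglandsDatum.nonempty` (cite-only) yields a datum
with SOME lawful Artin normalisation, and canonicity needs `IsLocalArtinMap.unique` + the
finite-level reciprocity law for that datum's Artin maps, or canonical variants of
`localLanglands_gl` / `nonempty_localEpsilonSystem` (needs-fact for -/
@[route_item "route-Langlands-TriangularRankLadder", crux]
def CanonicalReciprocityData : Prop :=
  ∀ (F : Type) [Field F] [NumberField F], Nonempty (Summit.Langlands.ReciprocityData F)

/-- item stmt-Langlands-24805 · support · rank 9 · open · by planner
sources: Weil1956, SerreAbelianLadic1968
[support] Grade 1 of the ladder: every (irreducible) pinned-geometric ℓ-adic character of Γ_K is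
weakly automorphic (an L-algebraic Hecke character matching a.e.). Verbatim the registered
stub_rankOne (Cruxes/SectorComplement/Lines/birth_WeakGeometricAutomorphy.lean); print: class field
theory + Weil 1956 + Serre 1968 III.2.3 + abelian Fontaine–Mazur. TAGS: WEAKER · PRINT ·
ATTACKABLE[closed-mod-print; = the registered `stub_rankOne` verbatim — one proof closes both].
[difficulty: provable-now] -/
@[route_item "route-Langlands-TriangularRankLadder", crux]
def RankOneAutomorphy : Prop :=
  ∀ (K : Type) [Field K] [NumberField K] (hcpt : Literature.NumberTheory.Automorphic.isCompact_glFiniteIntegralLevel 1 K) (ℓ : ℕ) [Fact ℓ.Prime] (ι : PadicAlgCl ℓ ≃+* ℂ) (ρ : Literature.NumberTheory.GaloisRepresentations.FramedGaloisRep K (PadicAlgCl ℓ) 1), ρ.toGaloisRep.IsIrreducible → ((∀ᶠ v : IsDedekindDomain.HeightOneSpectrum (NumberField.RingOfIntegers K) in cofinite, ρ.IsUnramifiedAt v) ∧ ∀ (v : IsDedekindDomain.HeightOneSpectrum (NumberField.RingOfIntegers K)) (hv : ((ℓ : ℕ) : NumberField.RingOfIntegers K) ∈ v.asIdeal), (Literature.NumberTheory.PAdicHodge.fontainePstAdicCompletion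 v ℓ hv).IsDeRhamFramed (ρ.toLocal v)) → ∃ π : Literature.NumberTheory.Automorphic.CuspidalAutomorphicRepData 1 K hcpt, π.1.IsLAlgebraic ∧ ∀ᶠ v : IsDedekindDomain.HeightOneSpectrum (NumberField.RingOfIntegers K) in cofinite, SatakeFrobCompatibleAt ι π.1 ρ v

/-- item stmt-Langlands-24806 · support · rank 9 · open · by planner
sources: ArthurClozelAMS120, Henniart2012
[support] The inductive step of the ladder, isolated: for an irreducible pinned-geometric ρ of rank
n ≥ 2 WITH a self-twist, weak automorphy at all ranks m < n (over all number fields) implies weak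
automorphy of ρ — Clifford (ρ ≅ Ind_E σ, E/K cyclic of prime degree) + cyclic automorphic induction
in Satake form (Arthur–Clozel Ch. 3 Thm 6.2, Lemma 6.4; Henniart 2012 at ∞); tree facts
automorphicInduction_cyclic_cuspidal(_unramified),
Henniart2012_infinityType_of_automorphicInduction,
ArthurClozel1989_automorphicInduction_of_selfTwist,
FramedGaloisRep.nonempty_equiv_of_hasFrobCharpolyAt_eventually. TAGS: WEAKER · PRINT (given all
lower grades) · ATTACKABLE[closed-mod-print: theorem
`FramedGaloisRep.nonempty_equiv_of_hasFrobCharpolyAt_eventually` (Chebotarev–Brauer–Nesbitt),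
Clifford, the AI Prop-facts and Henniart's archimedean theorems named above]. [difficulty: M] -/
@[route_item "route-Langlands-TriangularRankLadder", crux]
def CyclicInductionTransport : Prop :=
  ∀ (K : Type) [Field K] [NumberField K] (n : ℕ) (hcpt : Literature.NumberTheory.Automorphic.isCompact_glFiniteIntegralLevel n K), 2 ≤ n → ∀ (ℓ : ℕ) [Fact ℓ.Prime] (ι : PadicAlgCl ℓ ≃+* ℂ) (ρ : Literature.NumberTheory.GaloisRepresentations.FramedGaloisRep K (PadicAlgCl ℓ) n), ρ.toGaloisRep.IsIrreducible → ((∀ᶠ v : IsDedekindDomain.HeightOneSpectrum (NumberField.RingOfIntegers K) in Filter.cofinite, ρ.IsUnramifiedAt v) ∧ ∀ (v : IsDedekindDomain.HeightOneSpectrum (NumberField.RingOfIntegers K)) (hv : ((ℓ : ℕ) : NumberField.RingOfIntegers K) ∈ v.asIdeal), (Literature.NumberTheory.PAdicHodge.fontainePstAdicCompletion v ℓ hv).IsDeRhamFramed (ρ.toLocal v)) → (∃ η : Literature.NumberTheory.GaloisRepresentations.FramedGaloisRep K (PadicAlgCl ℓ) 1, (∃ᶠ v : IsDedekindDomain.HeightOneSpectrum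 (NumberField.RingOfIntegers K) in Filter.cofinite, ∃ a : PadicAlgCl ℓ, a ≠ 1 ∧ η.HasFrobCharpolyAt v (Polynomial.X - Polynomial.C a)) ∧ ∀ᶠ v : IsDedekindDomain.HeightOneSpectrum (NumberField.RingOfIntegers K) in Filter.cofinite, ∃ (P : Polynomial (PadicAlgCl ℓ)) (a : PadicAlgCl ℓ), ρ.HasFrobCharpolyAt v P ∧ η.HasFrobCharpolyAt v (Polynomial.X - Polynomial.C a) ∧ P.scaleRoots a = P) → (∀ m : ℕ, m < n → ∀ (E : Type) [Field E] [NumberField E] (hE : Literature.NumberTheory.Automorphic.isCompact_glFiniteIntegralLevel m E), 0 < m → ∀ (ℓ' : ℕ) [Fact ℓ'.Prime] (ι' : PadicAlgCl ℓ' ≃+* ℂ) (σ : Literature.NumberTheory.GaloisRepresentations.FramedGaloisRep E (PadicAlgCl ℓ') m), σ.toGaloisRep.IsIrreducible → ((∀ᶠ v : IsDedekindDomain.HeightOneSpectrum (NumberField.RingOfIntegers E) in Filter.cofinite, σ.IsUnramifiedAt v) ∧ ∀ (v : IsDedekindDomain.HeightOneSpectrum (NumberField.RingOfIntegers E)) (hv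 : ((ℓ' : ℕ) : NumberField.RingOfIntegers E) ∈ v.asIdeal), (Literature.NumberTheory.PAdicHodge.fontainePstAdicCompletion v ℓ' hv).IsDeRhamFramed (σ.toLocal v)) → ∃ π : Literature.NumberTheory.Automorphic.CuspidalAutomorphicRepData m E hE, π.1.IsLAlgebraic ∧ ∀ᶠ v : IsDedekindDomain.HeightOneSpectrum (NumberField.RingOfIntegers E) in Filter.cofinite, SatakeFrobCompatibleAt ι' π.1 σ v) → ∃ π : Literature.NumberTheory.Automorphic.CuspidalAutomorphicRepData n K hcpt, π.1.IsLAlgebraic ∧ ∀ᶠ v : IsDedekindDomain.HeightOneSpectrum (NumberField.RingOfIntegers K) in Filter.cofinite, SatakeFrobCompatibleAt ι π.1 ρ v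

/-- item stmt-Langlands-25720 · support · rank 9 · open · by planner
sources: ArthurClozelAMS120, JacquetShalikaAJM1981II
[support] Arthur–Clozel Ch. 3 (2.2) for Borel–Jacquet data: finite non-zero boundary values of the
partial Rankin–Selberg L-function on Re s = 1 off the polar set — the Literature named fact itself
(no _holds yet; = stmt-Langlands-13622 unfolded). TAGS (decomp-langlands crit-1 CLEARED
2026-08-30T02:39:41Z (HOME/STATUS.md L85; HOME/CRITIC-LEDGER.md row 20)): PRINT support = ALIAS of
the Literature named fact
`Literature.NumberTheory.Automorphic.JacquetShalika1981_partialPairL_boundary_repData`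
(PairLFunctionPolesRepData.lean :158, reduced there to L² leaves by the `_of_L2` theorems; =
stmt-Langlands-13622 unfolded) · ATTACKABLE (Literature proof item) · no catalogued barrier.
[difficulty: L] -/
@[route_item "route-Langlands-TriangularRankLadder", crux]
def PairLBoundary : Prop :=
  Literature.NumberTheory.Automorphic.JacquetShalika1981_partialPairL_boundary_repData

/-- item stmt-Langlands-25721 · support · rank 9 · open · by planner
sources: ArthurClozelAMS120, JacquetShalikaAJM1981II
[support] Arthur–Clozel Ch. 3 (2.3): the simple pole of the partial Rankin–Selberg L-function of a
cuspidal pair on the polar set — the Literature named fact itself (no _holds yet). TAGS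
(decomp-langlands crit-1 CLEARED 2026-08-30T02:39:41Z (HOME/STATUS.md L85; HOME/CRITIC-LEDGER.md row
20)): PRINT support = ALIAS of the Literature named fact
`Literature.NumberTheory.Automorphic.JacquetShalika1981_partialPairL_pole_repData`
(PairLFunctionPolesRepData.lean :182) · ATTACKABLE · no catalogued barrier. [difficulty: L] -/
@[route_item "route-Langlands-TriangularRankLadder", crux]
def PairLPole : Prop :=
  Literature.NumberTheory.Automorphic.JacquetShalika1981_partialPairL_pole_repData

/-- item stmt-Langlands-25722 · assembly · rank 1 · closed · proved by Summit.Langlands.Langlands.Theorems.triangularRankLadder_assembly_proof (prover) · by planner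
sources: ArthurClozelAMS120
[assembly] RankOneAutomorphy → RankTwoPrimitiveAutomorphy → HigherRankPrimitiveAutomorphy →
CyclicInductionTransport → GeometricAvatarExistence → PairLBoundary → PairLPole → CrossPrimeClass →
CompatibilityAwayFromLR → CanonicalReciprocityData → Langlands -/
@[route_item "route-Langlands-TriangularRankLadder"]
def Assembly : Prop :=
  RankOneAutomorphy → RankTwoPrimitiveAutomorphy → HigherRankPrimitiveAutomorphy → CyclicInductionTransport → GeometricAvatarExistence → PairLBoundary → PairLPole → CrossPrimeClass → CompatibilityAwayFromLR → CanonicalReciprocityData → _root_.Langlands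

-- `Assembly` holds: proved by `Summit.Langlands.Langlands.Theorems.triangularRankLadder_assembly_proof` (its module imports this route file, so no `_holds` link can be stated here).

/-! D-0027 §2.1 — DECIDING THEOREM (planner-authored via `route open/edit --closes-file`; by planner-decomp-langlands-writer-1-g2-0 2026-08-30T02:50:57Z):
its hypotheses are this route's items and its conclusion the sub-problem Statement (glue_lint), and it elaborates with this file. -/

/- (spliced by the gate into the rendered route file via `--closes-file`; certify with `ledger route check --native route.json --closes-file glue.lean`)
   D-0027 §2.1 deciding theorem for route TriangularRankLadder (decomp-langlands lens-1 gen 2; child of the born PrimitiveRankLadder).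
   Level 2 (B) = the sibling's strong induction on the rank (verbatim). Level 2 (A), NEW = the triangular coupling: every avatar at rank n is
   irreducible from W_geo[n] + B_w[<n] + AC (2.2)/(2.3) (landed bootstrap), and every irreducible avatar is de Rham by frame transport from the
   geometric one. Level 1 = N0's assembly with W⁺ := the geometric avatar (now irreducible) and P := de Rham transport + CrossPrimeClass. -/
@[closes "route-Langlands-TriangularRankLadder"] theorem closes (h1 : RankOneAutomorphy) (h2 : RankTwoPrimitiveAutomorphy) (h3 : HigherRankPrimitiveAutomorphy)
    (hT : CyclicInductionTransport) (hG : GeometricAvatarExistence) (h22 : PairLBoundary) (h23 : PairLPole)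
    (hX : CrossPrimeClass) (hA : CompatibilityAwayFromLR) (hR : CanonicalReciprocityData) : _root_.Langlands := by
  suffices hAsm : Assembly from hAsm h1 h2 h3 hT hG h22 h23 hX hA hR
  clear h1 h2 h3 hT hG h22 h23 hX hA hR
  intro h1 h2 h3 hT hG h22 h23 hX hA hR
  have hU := @_root_.Summit.Langlands.Langlands.Theorems.EisensteinDegreeShiftSectorComplement.stub_avatarConjugacy
  -- LEVEL 2 (B): weak geometric automorphy at every rank (strong induction on the rank) — sibling, verbatim
  have hAll : ∀ n : ℕ, ∀ (E : Type) [Field E] [NumberField E] (hE : Literature.NumberTheory.Automorphic.isCompact_glFiniteIntegralLevel n E), 0 < n → ∀ (ℓ' : ℕ) [Fact ℓ'.Prime] (ι' : PadicAlgCl ℓ' ≃+* ℂ) (σ : Literature.NumberTheory.GaloisRepresentations.FramedGaloisRep E (PadicAlgCl ℓ') n), σ.toGaloisRep.IsIrreducible → ((∀ᶠ v : IsDedekindDomain.HeightOneSpectrum (NumberField.RingOfIntegers E) in Filter.cofinite, σ.IsUnramifiedAt v) ∧ ∀ (v : IsDedekindDomain.HeightOneSpectrum (NumberField.RingOfIntegers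 E)) (hv : ((ℓ' : ℕ) : NumberField.RingOfIntegers E) ∈ v.asIdeal), (Literature.NumberTheory.PAdicHodge.fontainePstAdicCompletion v ℓ' hv).IsDeRhamFramed (σ.toLocal v)) → ∃ π : Literature.NumberTheory.Automorphic.CuspidalAutomorphicRepData n E hE, π.1.IsLAlgebraic ∧ ∀ᶠ v : IsDedekindDomain.HeightOneSpectrum (NumberField.RingOfIntegers E) in Filter.cofinite, SatakeFrobCompatibleAt ι' π.1 σ v := by
    intro n
    induction n using Nat.strong_induction_on with
    | _ n ih =>
      intro K _ _ hcpt hn ℓ _ ι ρ hirr hgeo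
      by_cases htw : (∃ η : Literature.NumberTheory.GaloisRepresentations.FramedGaloisRep K (PadicAlgCl ℓ) 1, (∃ᶠ v : IsDedekindDomain.HeightOneSpectrum (NumberField.RingOfIntegers K) in Filter.cofinite, ∃ a : PadicAlgCl ℓ, a ≠ 1 ∧ η.HasFrobCharpolyAt v (Polynomial.X - Polynomial.C a)) ∧ ∀ᶠ v : IsDedekindDomain.HeightOneSpectrum (NumberField.RingOfIntegers K) in Filter.cofinite, ∃ (P : Polynomial (PadicAlgCl ℓ)) (a : PadicAlgCl ℓ), ρ.HasFrobCharpolyAt v P ∧ η.HasFrobCharpolyAt v (Polynomial.X - Polynomial.C a) ∧ P.scaleRoots a = P)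
      · rcases Nat.lt_or_ge n 2 with hlt | hge
        · obtain rfl : n = 1 := by omega
          exact h1 K hcpt ℓ ι ρ hirr hgeo
        · exact hT K n hcpt hge ℓ ι ρ hirr hgeo htw (fun m hm => ih m hm)
      · rcases (show n = 1 ∨ n = 2 ∨ 3 ≤ n by omega) with h | h | h
        · subst h; exact h1 K hcpt ℓ ι ρ hirr hgeo
        · subst h; exact h2 K hcpt ℓ ι ρ hirr hgeo htw
        · exact h3 K n hcpt h ℓ ι ρ hirr hgeo htw
  -- LEVEL 2 (A): irreducibility of EVERY avatar at rank n from W_geo[n], B_w[<n] (hAll) and AC (2.2)/(2.3) — landed bootstrap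
  have hIrr : ∀ (K : Type) [Field K] [NumberField K] (n : ℕ) (hcpt : Literature.NumberTheory.Automorphic.isCompact_glFiniteIntegralLevel n K), 0 < n → ∀ (π : Literature.NumberTheory.Automorphic.CuspidalAutomorphicRepData n K hcpt), π.1.IsLAlgebraic → ∀ (ℓ : ℕ) [Fact ℓ.Prime] (ι : PadicAlgCl ℓ ≃+* ℂ) (ρ : Literature.NumberTheory.GaloisRepresentations.FramedGaloisRep K (PadicAlgCl ℓ) n), (∀ᶠ v : IsDedekindDomain.HeightOneSpectrum (NumberField.RingOfIntegers K) in Filter.cofinite, SatakeFrobCompatibleAt ι π.1 ρ v) → ρ.toGaloisRep.IsIrreducible := by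
    intro K _ _ n hcpt hn π hL ℓ _ ι ρ hρ
    obtain ⟨ρ₀, hgeo₀, hρ₀⟩ := hG K n hcpt hn π hL ℓ ι
    exact _root_.Summit.Langlands.Langlands.Theorems.IrreducibleOffSector.isIrreducible_of_geometric_of_weakAutomorphyBelow h22 h23 hn π ι hgeo₀ hρ₀
      (fun m hm0 hmn hm r hirr hgeo => by
        obtain ⟨σ, -, hσ⟩ := hAll m K hm hm0 ℓ ι r hirr hgeo
        exact ⟨σ, hσ⟩) ρ hρ
  -- de Rham-ness of every irreducible avatar: conjugate to the geometric one (Chebotarev + Brauer–Nesbitt), frame invariance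
  have hDR : ∀ (K : Type) [Field K] [NumberField K] (n : ℕ) (hcpt : Literature.NumberTheory.Automorphic.isCompact_glFiniteIntegralLevel n K), 0 < n → ∀ (π : Literature.NumberTheory.Automorphic.CuspidalAutomorphicRepData n K hcpt), π.1.IsLAlgebraic → ∀ (ℓ : ℕ) [Fact ℓ.Prime] (ι : PadicAlgCl ℓ ≃+* ℂ) (ρ : Literature.NumberTheory.GaloisRepresentations.FramedGaloisRep K (PadicAlgCl ℓ) n), ρ.toGaloisRep.IsIrreducible → (∀ᶠ v : IsDedekindDomain.HeightOneSpectrum (NumberField.RingOfIntegers K) in Filter.cofinite, SatakeFrobCompatibleAt ι π.1 ρ v) → ∀ (v : IsDedekindDomain.HeightOneSpectrum (NumberField.RingOfIntegers K)) (hv : ((ℓ : ℕ) : NumberField.RingOfIntegers K) ∈ v.asIdeal), (Literature.NumberTheory.PAdicHodge.fontainePstAdicCompletion v ℓ hv).IsDeRhamFramed (ρ.toLocal v) := by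
    intro K _ _ n hcpt hn π hL ℓ _ ι ρ hirr hρ v hv
    obtain ⟨ρ₀, hgeo₀, hρ₀⟩ := hG K n hcpt hn π hL ℓ ι
    have hirr₀ := hIrr K n hcpt hn π hL ℓ ι ρ₀ hρ₀
    obtain ⟨e⟩ := _root_.Literature.NumberTheory.GaloisRepresentations.FramedGaloisRep.nonempty_equiv_of_hasFrobCharpolyAt_eventually
      _root_.Literature.NumberTheory.Automorphic.chebotarev_artinRep_holds ρ₀ ρ
      (_root_.Summit.Langlands.Langlands.Theorems.IrreducibleOffSector.isSemisimple_of_isIrreducible ρ₀ hirr₀) (_root_.Summit.Langlands.Langlands.Theorems.IrreducibleOffSector.isSemisimple_of_isIrreducible ρ hirr)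
      (_root_.Summit.Langlands.Langlands.Theorems.IrreducibleOffSector.eventually_hasFrobCharpolyAt_common π.1 ι hρ₀ hρ)
    obtain ⟨P, hP⟩ := _root_.Literature.NumberTheory.GaloisRepresentations.FramedRep.exists_eq_conj_of_equiv ρ₀ ρ e
    subst hP
    exact (_root_.Literature.NumberTheory.GaloisRepresentations.PstWeilDeligneData.isDeRhamFramed_conj_iff _ P (ρ₀.toLocal v)).2 (hgeo₀.2 v hv)
  -- LEVEL 1: the frame of record (N0 = PrimeSwitchSplit rev 4), W⁺/P replaced by hG/hIrr/hDR/hX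
  intro F _ _
  refine ⟨hR F, fun Rec n hn hcpt => ?_⟩
  have hRec := hA F Rec
  have hprime : ∀ v : IsDedekindDomain.HeightOneSpectrum (NumberField.RingOfIntegers F),
      ∃ (ℓ' : ℕ) (_ : Fact ℓ'.Prime), ((ℓ' : ℕ) : NumberField.RingOfIntegers F) ∉ v.asIdeal := by
    intro v
    by_cases h2 : ((2 : ℕ) : NumberField.RingOfIntegers F) ∈ v.asIdeal
    · refine ⟨3, ⟨Nat.prime_three⟩, fun h3 => v.isPrime.ne_top ((Ideal.eq_top_iff_one _).2 ?_)⟩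
      have h := v.asIdeal.sub_mem h3 h2
      have h1 : ((3 : ℕ) : NumberField.RingOfIntegers F) - ((2 : ℕ) : NumberField.RingOfIntegers F) = 1 := by
        push_cast; norm_num
      rwa [h1] at h
    · exact ⟨2, ⟨Nat.prime_two⟩, h2⟩
  have hLGC : ∀ (π : Literature.NumberTheory.Automorphic.CuspidalAutomorphicRepData n F hcpt), π.1.IsLAlgebraic →
      ∀ (ℓ : ℕ) [Fact ℓ.Prime] (ι : PadicAlgCl ℓ ≃+* ℂ)
        (ρ : Literature.NumberTheory.GaloisRepresentations.FramedGaloisRep F (PadicAlgCl ℓ) n),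
        ρ.toGaloisRep.IsIrreducible →
        (∀ᶠ v : IsDedekindDomain.HeightOneSpectrum (NumberField.RingOfIntegers F) in Filter.cofinite,
          SatakeFrobCompatibleAt ι π.1 ρ v) →
        IsGeometricFramed Rec ρ ∧
          ∀ v : IsDedekindDomain.HeightOneSpectrum (NumberField.RingOfIntegers F),
            LocalGlobalCompatibleAt Rec ι π.1 ρ v := by
    intro π hL ℓ _ ι ρ hirr hρ
    have hgeo : (∀ᶠ v : IsDedekindDomain.HeightOneSpectrum (NumberField.RingOfIntegers F) in Filter.cofinite,
        ρ.IsUnramifiedAt v) ∧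
        ∀ (v : IsDedekindDomain.HeightOneSpectrum (NumberField.RingOfIntegers F))
          (hv : ((ℓ : ℕ) : NumberField.RingOfIntegers F) ∈ v.asIdeal),
          (Literature.NumberTheory.PAdicHodge.fontainePstAdicCompletion v ℓ hv).IsDeRhamFramed
            (ρ.toLocal v) :=
      ⟨hρ.mono fun v ⟨_, _, hur, _⟩ => hur, fun v hv => hDR F n hcpt hn π hL ℓ ι ρ hirr hρ v hv⟩
    refine ⟨hgeo, fun v => ?_⟩
    by_cases hv : ((ℓ : ℕ) : NumberField.RingOfIntegers F) ∈ v.asIdeal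
    · obtain ⟨ℓ', _, hℓ'⟩ := hprime v
      obtain ⟨ι'⟩ := PadicAlgCl.nonempty_ringEquiv_complex ℓ'
      obtain ⟨ρ', hgeo', hρ'⟩ := hG F n hcpt hn π hL ℓ' ι'
      have hirr' := hIrr F n hcpt hn π hL ℓ' ι' ρ' hρ'
      exact hX F n hcpt hn π hL ℓ ι ρ hirr hρ v hv Rec ℓ' ι' ρ' hℓ' hirr' hρ'
        (hRec n hcpt hn π hL ℓ' ι' ρ' hirr' hgeo' hρ' v hℓ')
    · exact hRec n hcpt hn π hL ℓ ι ρ hirr hgeo hρ v hv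
  refine ⟨?_, ?_⟩
  · intro π hL ℓ _ ι
    obtain ⟨ρ, -, hρ⟩ := hG F n hcpt hn π hL ℓ ι
    have hirr := hIrr F n hcpt hn π hL ℓ ι ρ hρ
    obtain ⟨hgeo, hloc⟩ := hLGC π hL ℓ ι ρ hirr hρ
    exact ⟨ρ, hirr, hgeo, ⟨hρ, hloc⟩, fun ρ' h' => hU F n hcpt π ℓ ι ρ ρ' hirr hρ h'.1⟩
  · intro ℓ _ ι ρ hirr hgeo
    obtain ⟨π, hL, hρ⟩ := hAll n F hcpt hn ℓ ι ρ hirr hgeo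
    exact ⟨π, hL, hρ, (hLGC π hL ℓ ι ρ hirr hρ).2⟩

end Summit.Langlands.Langlands.Theses.TriangularRankLadder
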